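import Summits.Ventures.CertifiedArithmetic.LowPrec.OptTreePoly

/-!
# OptTreeMixed — Theorem T5: the node-weighted (mixed-precision) tree polynomial law, upper bound

HONEST FRAMING: certified error envelopes and provably optimal rounding/accumulation schemes for
low-precision formats under stated cost models; every table by two implementations; no hardware or
vendor claims.

Cost model CM-B of the `pub-lowprec` OPT seat (two-level / blocked / periodically promoted accumulation)
made exact.  A *precision-labelled* summation tree `PTree` has rational leaves and, at every internal
node, the precision `p` (number of significand bits) of the binary format `F(p, emin)` into which that
addition is rounded (common `emin`, gradual underflow, no overflow; `u_p = 2^-p`).  Its node-weighted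
tree polynomial is `M(leaf) = 1`, `M(node_p(a,b)) = max(M a, M b) + u_p · min(M a, M b)`
(`treeMP`).  The tree is *well formed* (`WF`) when the precision never decreases from a child addition
to its parent addition (the wide additions form an upper set: a promotion / blocking structure) and every
leaf is a nonnegative number representable at its parent's precision.

* `exactP_le_treeMP_mul_evalP` — **Theorem U-mixed (abstract)**: for label-indexed representability
  predicates `P p` that are monotone in `p`, and rounding maps `fl p` into `P p` that never round a
  nonnegative sum of two `P p`-numbers below either operand and satisfy `a + b ≤ (1 + u_p) fl_p(a + b)`,
  every well-formed tree obeys `exact ≤ M_t · computed`.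
* `exactP_sub_evalP_le_roundNearest` — instantiation: ANY family of round-to-nearest maps
  `fl p : ℚ → F(p, emin)` (any tie rules, possibly different per precision): relative under-estimation
  `≤ 1 - 1/M_t`.  `R4_MixedTreePolyUnderestimation` is the Statement-style `Prop` with its `_holds`.
* `treeMP_const` / `evalP_const` — with all labels equal the law is Theorem T4's (`OptTreePoly`).

Sharpness under ties-to-even (the bound is attained for every well-formed tree) is
`LowPrec/OptTreeMixedWitness.lean`; the product formula and the optimal two-level designs are
`LowPrec/OptTreeMixedDesign.lean`.  Well-formedness is NECESSARY: with a narrow addition above a wide one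
(demotion = double rounding) the law fails, e.g. precisions (3,5), tree
`node₃(node₅(node₅(L,L), node₅(L,L)), L)` on inputs (1, 40, 8, 256, 0): computed 256, exact 305,
305/256 > M = 1217/1024 (certificate C15, `certs/opt/mixedpoly_DIFF.txt`, re-evaluated by two
implementations).
-/

namespace Summit.Ventures.CertifiedArithmetic.LowPrec.Opt

open Literature.ComputerArithmetic.JeannerodRump2018

/-- Precision-labelled summation tree: rational leaves; `node p l r` is one addition rounded into the
format with `p` significand bits. -/
inductive PTree : Type
  | leaf : ℚ → PTree
  | node : ℕ → PTree → PTree → PTree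

namespace PTree

/-- Exact sum of the leaves. -/
def exactP : PTree → ℚ
  | leaf x => x
  | node _ l r => exactP l + exactP r

/-- Computed value: the addition at a node labelled `p` is rounded by `fl p`. -/
def evalP (fl : ℕ → ℚ → ℚ) : PTree → ℚ
  | leaf x => x
  | node p l r => fl p (evalP fl l + evalP fl r)

/-- Node-weighted tree polynomial: `1` at a leaf, `max + u_p · min` of the children at a node labelled `p`. -/
def treeMP (u : ℕ → ℚ) : PTree → ℚ
  | leaf _ => 1
  | node p l r => max (treeMP u l) (treeMP u r) + u p * min (treeMP u l) (treeMP u r)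

/-- Forget the labels (to compare with the single-precision tree polynomial of `OptTreePoly`). -/
def forget : PTree → SumTree
  | leaf x => .leaf x
  | node _ l r => .node (forget l) (forget r)

/-- Condition on a subtree sitting directly below an addition of precision `p`: a leaf must be a
nonnegative `P p`-number; a child addition must have precision `≤ p` (no demotion). -/
def RootOK (P : ℕ → ℚ → Prop) (p : ℕ) : PTree → Prop
  | leaf x => P p x ∧ 0 ≤ x
  | node q _ _ => q ≤ p

/-- Well-formed (promotion-structured) labelled tree: every child satisfies `RootOK` for its parent's
precision, recursively.  A lone leaf is well formed. -/
def WF (P : ℕ → ℚ → Prop) : PTree → Prop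
  | leaf _ => True
  | node p l r => RootOK P p l ∧ RootOK P p r ∧ WF P l ∧ WF P r

/-- The exact sum of a leaf. -/
@[simp] theorem exactP_leaf (x : ℚ) : exactP (leaf x) = x := rfl
/-- The exact sum of a node. -/
@[simp] theorem exactP_node (p : ℕ) (l r : PTree) : exactP (node p l r) = exactP l + exactP r := rfl
/-- The computed value of a leaf. -/
@[simp] theorem evalP_leaf (fl : ℕ → ℚ → ℚ) (x : ℚ) : evalP fl (leaf x) = x := rfl
/-- The computed value of a node labelled `p`: `fl p` of the sum of the children's values. -/
@[simp] theorem evalP_node (fl : ℕ → ℚ → ℚ) (p : ℕ) (l r : PTree) :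
    evalP fl (node p l r) = fl p (evalP fl l + evalP fl r) := rfl
/-- `M(leaf) = 1`. -/
@[simp] theorem treeMP_leaf (u : ℕ → ℚ) (x : ℚ) : treeMP u (leaf x) = 1 := rfl
/-- `M(node_p l r) = max + u_p · min` of the children. -/
@[simp] theorem treeMP_node (u : ℕ → ℚ) (p : ℕ) (l r : PTree) :
    treeMP u (node p l r) = max (treeMP u l) (treeMP u r) + u p * min (treeMP u l) (treeMP u r) := rfl
/-- `RootOK` at a leaf: a nonnegative `P p`-number. -/
@[simp] theorem rootOK_leaf (P : ℕ → ℚ → Prop) (p : ℕ) (x : ℚ) :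
    RootOK P p (leaf x) ↔ P p x ∧ 0 ≤ x := Iff.rfl
/-- `RootOK` at a child addition: its precision does not exceed the parent's. -/
@[simp] theorem rootOK_node (P : ℕ → ℚ → Prop) (p q : ℕ) (l r : PTree) :
    RootOK P p (node q l r) ↔ q ≤ p := Iff.rfl
/-- A lone leaf is well formed. -/
@[simp] theorem wf_leaf (P : ℕ → ℚ → Prop) (x : ℚ) : WF P (leaf x) := trivial
/-- Well-formedness at a node, unfolded. -/
@[simp] theorem wf_node (P : ℕ → ℚ → Prop) (p : ℕ) (l r : PTree) :
    WF P (node p l r) ↔ RootOK P p l ∧ RootOK P p r ∧ WF P l ∧ WF P r := Iff.rfl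

/-- With all labels read through a constant weight, the node-weighted polynomial is the tree polynomial
of `OptTreePoly` on the unlabelled tree (Theorem T5 specialises to Theorem T4). -/
theorem treeMP_const (c : ℚ) : ∀ t : PTree, treeMP (fun _ => c) t = treeM c (forget t)
  | leaf _ => rfl
  | node _ l r => by simp [treeMP, forget, treeMP_const c l, treeMP_const c r]

/-- With one rounding map at every node, the computed value is `SumTree.eval` of the unlabelled tree. -/
theorem evalP_const (f : ℚ → ℚ) : ∀ t : PTree, evalP (fun _ => f) t = SumTree.eval f (forget t)
  | leaf _ => rfl
  | node _ l r => by simp [evalP, SumTree.eval, forget, evalP_const f l, evalP_const f r]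

/-- The exact sum does not see the labels. -/
theorem exactP_eq (t : PTree) : exactP t = SumTree.exact (forget t) := by
  induction t with
  | leaf x => rfl
  | node _ l r ihl ihr => simp [exactP, SumTree.exact, forget, ihl, ihr]

/-- `1 ≤ M_t` when every weight is nonnegative. -/
theorem one_le_treeMP {u : ℕ → ℚ} (hu : ∀ p, 0 ≤ u p) : ∀ t : PTree, 1 ≤ treeMP u t
  | leaf _ => by simp
  | node p l r => by
      have hl := one_le_treeMP hu l
      have hr := one_le_treeMP hu r
      rw [treeMP_node]
      have h1 : 1 ≤ max (treeMP u l) (treeMP u r) := le_trans hl (le_max_left _ _)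
      have h2 : 0 ≤ min (treeMP u l) (treeMP u r) := le_min (by linarith) (by linarith)
      nlinarith [mul_nonneg (hu p) h2]

/-- `0 < M_t`. -/
theorem treeMP_pos {u : ℕ → ℚ} (hu : ∀ p, 0 ≤ u p) (t : PTree) : 0 < treeMP u t :=
  lt_of_lt_of_le zero_lt_one (one_le_treeMP hu t)

/-! ## Theorem U-mixed (abstract) -/

/-- **Theorem U-mixed (abstract form, with the invariant).**  `P p` = "representable at precision `p`",
monotone in `p`; `fl p` maps into `P p`, never rounds a nonnegative sum of two `P p`-numbers below either
operand (h1) and satisfies `a + b ≤ (1 + u_p) · fl_p (a + b)` (h2).  Then for every well-formed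
labelled tree sitting below precision `p`: `exact ≤ M_t · computed`, the computed value is a
`P p`-number, and it is nonnegative. -/
theorem exactP_le_treeMP_mul_evalP_inv {u : ℕ → ℚ} (hu0 : ∀ p, 0 ≤ u p) (P : ℕ → ℚ → Prop)
    (fl : ℕ → ℚ → ℚ) (hmono : ∀ q p x, q ≤ p → P q x → P p x) (hP : ∀ p s, P p (fl p s))
    (h1 : ∀ p a b, P p a → P p b → 0 ≤ a → 0 ≤ b → max a b ≤ fl p (a + b))
    (h2 : ∀ p a b, P p a → P p b → 0 ≤ a → 0 ≤ b → a + b ≤ (1 + u p) * fl p (a + b)) :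
    ∀ (t : PTree) (p : ℕ), WF P t → RootOK P p t →
      exactP t ≤ treeMP u t * evalP fl t ∧ P p (evalP fl t) ∧ 0 ≤ evalP fl t
  | leaf x, p, _, hr => by
      rw [rootOK_leaf] at hr
      simp only [exactP_leaf, treeMP_leaf, evalP_leaf, one_mul]
      exact ⟨le_rfl, hr.1, hr.2⟩
  | node q l r, p, hw, hr => by
      rw [rootOK_node] at hr
      rw [wf_node] at hw
      obtain ⟨hl, hr', wl, wr⟩ := hw
      obtain ⟨ihl, Pl, Al⟩ := exactP_le_treeMP_mul_evalP_inv hu0 P fl hmono hP h1 h2 l q wl hl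
      obtain ⟨ihr, Pr, Br⟩ := exactP_le_treeMP_mul_evalP_inv hu0 P fl hmono hP h1 h2 r q wr hr'
      simp only [exactP_node, evalP_node, treeMP_node]
      have hR1 := h1 q _ _ Pl Pr Al Br
      have hR2 := h2 q _ _ Pl Pr Al Br
      exact ⟨node_step (hu0 q) (one_le_treeMP hu0 l) (one_le_treeMP hu0 r) Al Br ihl ihr hR1 hR2,
        hmono q p _ hr (hP q _), le_trans Al (le_trans (le_max_left _ _) hR1)⟩

/-- **Theorem U-mixed (abstract).**  For every well-formed labelled tree, `exact ≤ M_t · computed`. -/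
theorem exactP_le_treeMP_mul_evalP {u : ℕ → ℚ} (hu0 : ∀ p, 0 ≤ u p) (P : ℕ → ℚ → Prop)
    (fl : ℕ → ℚ → ℚ) (hmono : ∀ q p x, q ≤ p → P q x → P p x) (hP : ∀ p s, P p (fl p s))
    (h1 : ∀ p a b, P p a → P p b → 0 ≤ a → 0 ≤ b → max a b ≤ fl p (a + b))
    (h2 : ∀ p a b, P p a → P p b → 0 ≤ a → 0 ≤ b → a + b ≤ (1 + u p) * fl p (a + b))
    (t : PTree) (hw : WF P t) : exactP t ≤ treeMP u t * evalP fl t := by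
  cases t with
  | leaf x => simp
  | node q l r =>
      exact (exactP_le_treeMP_mul_evalP_inv hu0 P fl hmono hP h1 h2 (node q l r) q hw
        ((rootOK_node P q q l r).mpr le_rfl)).1

/-- The computed value of a well-formed tree with nonnegative leaves is nonnegative (abstract form). -/
theorem evalP_nonneg {u : ℕ → ℚ} (hu0 : ∀ p, 0 ≤ u p) (P : ℕ → ℚ → Prop)
    (fl : ℕ → ℚ → ℚ) (hmono : ∀ q p x, q ≤ p → P q x → P p x) (hP : ∀ p s, P p (fl p s))
    (h1 : ∀ p a b, P p a → P p b → 0 ≤ a → 0 ≤ b → max a b ≤ fl p (a + b))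
    (h2 : ∀ p a b, P p a → P p b → 0 ≤ a → 0 ≤ b → a + b ≤ (1 + u p) * fl p (a + b))
    (t : PTree) (hw : WF P t) (hleaf : ∀ x, t = leaf x → 0 ≤ x) : 0 ≤ evalP fl t := by
  cases t with
  | leaf x => simpa using hleaf x rfl
  | node q l r =>
      exact (exactP_le_treeMP_mul_evalP_inv hu0 P fl hmono hP h1 h2 (node q l r) q hw
        ((rootOK_node P q q l r).mpr le_rfl)).2.2

/-- Corollary: relative under-estimation `exact - computed ≤ (1 - 1/M_t) · exact`. -/
theorem exactP_sub_evalP_le {u : ℕ → ℚ} (hu0 : ∀ p, 0 ≤ u p) (P : ℕ → ℚ → Prop)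
    (fl : ℕ → ℚ → ℚ) (hmono : ∀ q p x, q ≤ p → P q x → P p x) (hP : ∀ p s, P p (fl p s))
    (h1 : ∀ p a b, P p a → P p b → 0 ≤ a → 0 ≤ b → max a b ≤ fl p (a + b))
    (h2 : ∀ p a b, P p a → P p b → 0 ≤ a → 0 ≤ b → a + b ≤ (1 + u p) * fl p (a + b))
    (t : PTree) (hw : WF P t) :
    exactP t - evalP fl t ≤ (1 - 1 / treeMP u t) * exactP t := by
  have h := exactP_le_treeMP_mul_evalP hu0 P fl hmono hP h1 h2 t hw
  have hM0 : 0 < treeMP u t := treeMP_pos hu0 t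
  rw [sub_mul, one_mul, div_mul_eq_mul_div, one_mul]
  have : exactP t / treeMP u t ≤ evalP fl t := by
    rw [div_le_iff₀ hM0]; linarith [mul_comm (treeMP u t) (evalP fl t)]
  linarith

/-! ## Instantiation: a family of round-to-nearest maps into `F(p, emin)`, any tie rules -/

/-- `F(q, emin) ⊆ F(p, emin)` for `q ≤ p`. -/
theorem isFloat_mono {q p : ℕ} {emin : ℤ} {x : ℚ} (hqp : q ≤ p) (hx : IsFloat q emin x) :
    IsFloat p emin x := by
  obtain ⟨M, e, hM, he, rfl⟩ := hx
  exact ⟨M, e, lt_of_lt_of_le hM (pow_le_pow_right₀ (by norm_num) hqp), he, rfl⟩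

/-- `F(0, emin) = {0}`. -/
theorem eq_zero_of_isFloat_zero {emin : ℤ} {x : ℚ} (hx : IsFloat 0 emin x) : x = 0 := by
  obtain ⟨M, e, hM, -, rfl⟩ := hx
  have hM0 : M = 0 := Int.abs_lt_one_iff.mp (by simpa using hM)
  simp [hM0]

/-- (h2) for every precision, including the degenerate `p = 0` (where both operands are `0`). -/
theorem add_le_one_add_u_mul_fl_all {p : ℕ} {emin : ℤ} {fl : ℚ → ℚ} (hfl : IsRoundNearest p emin fl)
    {a b : ℚ} (ha : IsFloat p emin a) (hb : IsFloat p emin b) (ha0 : 0 ≤ a) (hb0 : 0 ≤ b) :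
    a + b ≤ (1 + unitRoundoff p) * fl (a + b) := by
  by_cases hp : 1 ≤ p
  · exact add_le_one_add_u_mul_fl hp hfl ha hb ha0 hb0
  · have hp0 : p = 0 := by omega
    subst hp0
    have ha' := eq_zero_of_isFloat_zero ha
    have hb' := eq_zero_of_isFloat_zero hb
    subst ha'; subst hb'
    have h0 : fl (0 + 0) = 0 := eq_zero_of_isFloat_zero (hfl (0 + 0)).1
    rw [h0]; simp

/-- **Theorem U-mixed for round-to-nearest** (any tie rule at every precision, gradual underflow, no
overflow): for every well-formed precision-labelled tree with nonnegative representable leaves,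
`exact ≤ M_t · computed` with node weights `u_p = 2^-p`. -/
theorem exactP_le_treeMP_mul_evalP_roundNearest {emin : ℤ} {fl : ℕ → ℚ → ℚ}
    (hfl : ∀ p, IsRoundNearest p emin (fl p)) (t : PTree) (hw : WF (fun p x => IsFloat p emin x) t) :
    exactP t ≤ treeMP (fun p => unitRoundoff p) t * evalP fl t :=
  exactP_le_treeMP_mul_evalP (fun p => unitRoundoff_nonneg p) (fun p x => IsFloat p emin x) fl
    (fun _ _ _ hqp hx => isFloat_mono hqp hx) (fun p s => (hfl p s).1)
    (fun p _ _ ha hb ha0 hb0 => max_le_fl_add (hfl p) ha hb ha0 hb0)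
    (fun p _ _ ha hb ha0 hb0 => add_le_one_add_u_mul_fl_all (hfl p) ha hb ha0 hb0) t hw

/-- Relative under-estimation form: `exact - computed ≤ (1 - 1/M_t) · exact`. -/
theorem exactP_sub_evalP_le_roundNearest {emin : ℤ} {fl : ℕ → ℚ → ℚ}
    (hfl : ∀ p, IsRoundNearest p emin (fl p)) (t : PTree) (hw : WF (fun p x => IsFloat p emin x) t) :
    exactP t - evalP fl t ≤ (1 - 1 / treeMP (fun p => unitRoundoff p) t) * exactP t :=
  exactP_sub_evalP_le (fun p => unitRoundoff_nonneg p) (fun p x => IsFloat p emin x) fl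
    (fun _ _ _ hqp hx => isFloat_mono hqp hx) (fun p s => (hfl p s).1)
    (fun p _ _ ha hb ha0 hb0 => max_le_fl_add (hfl p) ha hb ha0 hb0)
    (fun p _ _ ha hb ha0 hb0 => add_le_one_add_u_mul_fl_all (hfl p) ha hb ha0 hb0) t hw

/-- The single-precision Theorem U of `OptTreePoly` is the constant-label case (consistency check):
for a tree all of whose additions are rounded by one round-to-nearest map into `F(p, emin)`. -/
theorem exactP_le_const_label {p : ℕ} {emin : ℤ} {f : ℚ → ℚ} (hp : 1 ≤ p)
    (hf : IsRoundNearest p emin f) (t : PTree)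
    (ht : ∀ x ∈ SumTree.leaves (forget t), IsFloat p emin x ∧ 0 ≤ x) :
    exactP t ≤ treeMP (fun _ => unitRoundoff p) t * evalP (fun _ => f) t := by
  rw [treeMP_const, evalP_const, exactP_eq]
  exact exact_le_treeM_mul_eval_roundNearest hp hf (forget t) ht

end PTree

/-! ## Statement-style R4 proposition (same shape as `LowPrec/OptTreeR4.lean`, kept out of the full
`Statement.lean`) -/

open PTree in
/-- R4 (Opt, CM-B exact, Theorem T5 upper bound): for ANY family of round-to-nearest maps into the binary
formats `F(p, emin)` (one per precision label, any tie rules) and every well-formed precision-labelled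
summation tree with nonnegative representable leaves, the relative under-estimation of the computed sum is
at most `1 - 1/M_t`, `M_t` the node-weighted tree polynomial with weights `u_p = 2^-p`. -/
def R4_MixedTreePolyUnderestimation : Prop :=
  ∀ (emin : ℤ) (fl : ℕ → ℚ → ℚ), (∀ p, IsRoundNearest p emin (fl p)) →
    ∀ t : PTree, WF (fun p x => IsFloat p emin x) t →
      exactP t - evalP fl t ≤ (1 - 1 / treeMP (fun p => unitRoundoff p) t) * exactP t

open PTree in
/-- Discharge of `R4_MixedTreePolyUnderestimation`. -/
theorem R4_MixedTreePolyUnderestimation_holds : R4_MixedTreePolyUnderestimation :=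
  fun _ _ hfl t hw => exactP_sub_evalP_le_roundNearest hfl t hw

end Summit.Ventures.CertifiedArithmetic.LowPrec.Opt
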